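import Summits.Ventures.PercRepro.C026PFunTwoLiveLeaf
import Summits.Ventures.PercRepro.C026ClassEdge

/-!
# The pendant probe: the edge lemmas (p6, gen 20)

The lemmas behind `C026PFunPendantProbe` («`(E00)` is invariant under a pendant probe»).  The probe
`c` is **pendant**: its only edge is `e = c–u`.  Then a red or blue connection between two vertices
other than `c` never uses `e` (`conn_update_iff_of_ne`, `conn_compl_update_iff_of_ne`: the contraction
lemma `conn_update_true_iff`, the alternatives would join the endpoints to the then isolated `c`), with
`e` open `c` is joined exactly to what `u` is joined to (`conn_c_iff_conn_u`) and is blue-isolated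
(`not_conn_compl_c_of_open`), with `e` closed `c` is red-isolated (`not_conn_c_of_closed`).  Two
involutions of the cube: the flip `flipE e` of the edge `e`, with the **doubling** lemma
`card_filter_eq_two_mul_of_flipE` (a property invariant under the flip is shared equally by the
configurations with `e` open and with `e` closed), and `complE e S = (Sᶜ with e re-opened)`, an
involution of the configurations with `e` open.
-/

namespace PercRepro

namespace MultiGraph

open Finset

variable {V E : Type*} {G : MultiGraph V E}

section Pendant

variable [DecidableEq E] {e : E} {c u : V}

omit [DecidableEq E] in
/-- The probe has no open edge when its only edge is closed. -/
theorem isolated_of_leaf_closed {S : Config E} (hleaf : ∀ f, G.fst f = c ∨ G.snd f = c → f = e)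
    (hS : S e = false) : ∀ f, S f = true → G.fst f ≠ c ∧ G.snd f ≠ c := by
  intro f hf
  by_contra h
  have hfe : f = e := hleaf f (by
    by_cases h1 : G.fst f = c
    · exact Or.inl h1
    · exact Or.inr (by
        by_contra h2
        exact h ⟨h1, h2⟩))
  subst hfe
  rw [hS] at hf
  exact absurd hf (by decide)

omit [DecidableEq E] in
/-- With its edge `e = c–u` open, the probe is joined exactly to what `u` is joined to. -/
theorem conn_c_iff_conn_u {S : Config E}
    (hend : (G.fst e = c ∧ G.snd e = u) ∨ (G.fst e = u ∧ G.snd e = c)) (hS : S e = true)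
    (x : V) : G.Conn S c x ↔ G.Conn S u x := by
  have hcu : G.Conn S c u := by
    rcases hend with ⟨h1, h2⟩ | ⟨h1, h2⟩
    · exact Conn.of_openAdj ⟨e, hS, Or.inl ⟨h1, h2⟩⟩
    · exact Conn.of_openAdj ⟨e, hS, Or.inr ⟨h1, h2⟩⟩
  exact ⟨fun h => hcu.symm.trans h, fun h => hcu.trans h⟩

/-- A connection between two vertices other than `c` never needs the pendant edge: closing `e` keeps
it (the contraction lemma; the alternatives would join `x` or `y` to the then isolated `c`). -/
theorem conn_update_false_iff_of_ne {S : Config E}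
    (hleaf : ∀ f, G.fst f = c ∨ G.snd f = c → f = e)
    (hend : (G.fst e = c ∧ G.snd e = u) ∨ (G.fst e = u ∧ G.snd e = c)) {x y : V}
    (hx : x ≠ c) (hy : y ≠ c) : G.Conn (Function.update S e false) x y ↔ G.Conn S x y := by
  refine ⟨fun h => h.mono (update_false_le S e), fun h => ?_⟩
  set ω := Function.update S e false with hω
  have hiso := isolated_of_leaf_closed (S := ω) hleaf (by simp [hω])
  by_cases he : S e = true
  · have hS : S = Function.update ω e true := by
      rw [hω, Function.update_idem, ← he, Function.update_eq_self]
    rw [hS] at h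
    rcases (conn_update_true_iff ω e x y).1 h with h | ⟨h1, h2⟩ | ⟨h1, h2⟩
    · exact h
    · exfalso
      rcases hend with ⟨h3, _⟩ | ⟨_, h4⟩
      · rw [h3] at h1
        exact hx (eq_of_conn_of_isolated hiso h1.symm)
      · rw [h4] at h2
        exact hy (eq_of_conn_of_isolated hiso h2)
    · exfalso
      rcases hend with ⟨h3, _⟩ | ⟨_, h4⟩
      · rw [h3] at h2
        exact hy (eq_of_conn_of_isolated hiso h2)
      · rw [h4] at h1
        exact hx (eq_of_conn_of_isolated hiso h1.symm)
  · have hS : S = ω := by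
      rw [hω]
      funext f
      by_cases hf : f = e
      · subst hf
        simp only [Function.update_self]
        exact Bool.eq_false_iff.2 he
      · simp [Function.update_of_ne hf]
    rw [hS] at h
    exact h

/-- The state of the pendant edge is irrelevant for red connections between vertices other than
`c`. -/
theorem conn_update_iff_of_ne {S : Config E}
    (hleaf : ∀ f, G.fst f = c ∨ G.snd f = c → f = e)
    (hend : (G.fst e = c ∧ G.snd e = u) ∨ (G.fst e = u ∧ G.snd e = c)) {x y : V}
    (hx : x ≠ c) (hy : y ≠ c) (v : Bool) :
    G.Conn (Function.update S e v) x y ↔ G.Conn S x y := by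
  rw [← conn_update_false_iff_of_ne hleaf hend hx hy (S := Function.update S e v),
    Function.update_idem, conn_update_false_iff_of_ne hleaf hend hx hy]

/-- The complement of an update is the update of the complement. -/
theorem compl_update_eq (S : Config E) (f : E) (v : Bool) :
    (Function.update S f v)ᶜ = Function.update Sᶜ f (!v) := by
  funext g
  by_cases hg : g = f
  · subst hg
    simp
  · simp [Function.update_of_ne hg]

/-- The state of the pendant edge is irrelevant for blue connections between vertices other than
`c`. -/
theorem conn_compl_update_iff_of_ne {S : Config E}
    (hleaf : ∀ f, G.fst f = c ∨ G.snd f = c → f = e)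
    (hend : (G.fst e = c ∧ G.snd e = u) ∨ (G.fst e = u ∧ G.snd e = c)) {x y : V}
    (hx : x ≠ c) (hy : y ≠ c) (v : Bool) :
    G.Conn (Function.update S e v)ᶜ x y ↔ G.Conn Sᶜ x y := by
  rw [compl_update_eq]
  exact conn_update_iff_of_ne hleaf hend hx hy (!v)

omit [DecidableEq E] in
/-- With the pendant edge open, the probe is blue-isolated. -/
theorem not_conn_compl_c_of_open {S : Config E}
    (hleaf : ∀ f, G.fst f = c ∨ G.snd f = c → f = e) (hS : S e = true) {x : V} (hx : x ≠ c) :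
    ¬ G.Conn Sᶜ c x := by
  intro h
  have hiso := isolated_of_leaf_closed (S := Sᶜ) hleaf (by rw [Pi.compl_apply, hS]; rfl)
  exact hx (eq_of_conn_of_isolated hiso h)

omit [DecidableEq E] in
/-- With the pendant edge closed, the probe is red-isolated. -/
theorem not_conn_c_of_closed {S : Config E}
    (hleaf : ∀ f, G.fst f = c ∨ G.snd f = c → f = e) (hS : S e = false) {x : V} (hx : x ≠ c) :
    ¬ G.Conn S c x := by
  intro h
  exact hx (eq_of_conn_of_isolated (isolated_of_leaf_closed hleaf hS) h)

/-- The flip of the pendant edge. -/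
def flipE (e : E) (S : Config E) : Config E := Function.update S e (!S e)

/-- Flipping twice is the identity. -/
theorem flipE_flipE (e : E) (S : Config E) : flipE e (flipE e S) = S := by
  unfold flipE
  rw [Function.update_self, Bool.not_not, Function.update_idem, Function.update_eq_self]

/-- The flip changes the state of `e`. -/
theorem flipE_apply_self (e : E) (S : Config E) : flipE e S e = !S e := by
  simp [flipE]

section Count

variable [Fintype E]

/-- **Doubling**: a property invariant under the flip of `e` is shared equally by the configurations
with `e` open and with `e` closed. -/
theorem card_filter_eq_two_mul_of_flipE (e : E) (P : Config E → Prop) [DecidablePred P]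
    (hP : ∀ S, P (flipE e S) ↔ P S) :
    (univ.filter P).card = 2 * (univ.filter fun S : Config E => S e = true ∧ P S).card := by
  have hsplit := Finset.card_filter_add_card_filter_not (s := univ.filter P)
    (fun S : Config E => S e = true)
  rw [Finset.filter_filter, Finset.filter_filter] at hsplit
  have hbij : (univ.filter fun S : Config E => P S ∧ ¬ S e = true).card =
      (univ.filter fun S : Config E => P S ∧ S e = true).card := by
    refine Finset.card_nbij' (flipE e) (flipE e) ?_ ?_ ?_ ?_
    · intro S hS
      simp only [coe_filter, mem_univ, true_and, Set.mem_setOf_eq] at hS ⊢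
      refine ⟨(hP S).2 hS.1, ?_⟩
      rw [flipE_apply_self, Bool.eq_false_iff.2 hS.2]
      rfl
    · intro S hS
      simp only [coe_filter, mem_univ, true_and, Set.mem_setOf_eq] at hS ⊢
      refine ⟨(hP S).2 hS.1, ?_⟩
      rw [flipE_apply_self, hS.2]
      decide
    · intro S _
      exact flipE_flipE e S
    · intro S _
      exact flipE_flipE e S
  have hcomm : (univ.filter fun S : Config E => P S ∧ S e = true) =
      (univ.filter fun S : Config E => S e = true ∧ P S) := by
    apply Finset.filter_congr
    intro S _
    exact and_comm
  rw [hcomm] at hbij hsplit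
  omega

omit [Fintype E] in
/-- The flip of `e` is an update. -/
theorem flipE_eq_update (e : E) (S : Config E) : flipE e S = Function.update S e (!S e) := rfl

/-- Complementation followed by re-opening `e`. -/
def complE (e : E) (S : Config E) : Config E := Function.update Sᶜ e true

omit [Fintype E] in
/-- `complE` is an involution on the configurations with `e` open. -/
theorem complE_complE {S : Config E} (hS : S e = true) : complE e (complE e S) = S := by
  unfold complE
  rw [compl_update_eq, compl_compl, Function.update_idem, ← hS, Function.update_eq_self]

omit [Fintype E] in
/-- `complE` keeps `e` open. -/
theorem complE_apply_self (S : Config E) : complE e S e = true := by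
  simp [complE]


end Count

end Pendant

end MultiGraph

end PercRepro
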